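/-
Origin: expansion seat `planner-pub-hodgecm-pv13-g3-0`, handover #2b 2026-08-18T06:32:59Z (`HOME/pub-hodgecm-pv13-g3/lean/Pv13g3/SplitPlaceDilation.lean`, md5 5121f070, 162 lines);
landed by the gen-7 packager in gate run 25 as `HodgeCM/PerL34/SplitPlaceDilation.lean` (import ^import Pv13g3\.→import HodgeCM.PerL34. ×1).
-/
/-
Copyright: HodgeCM publication cell (pub-hodgecm), DAG node N31 — seam S3, split places: the D4 dictionary
(prover pv13, gen 3).  Released under the package licence.

# The split-place model datum from the dilation model, with `q` KERNEL

Source under adjudication (NOT cited as a fact; this file PROVES typed pieces of it):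
PerL v5 = `inputs/2001/summits__hodge-w-picard-modular-quadrilinear-period-galois-
closure__free__y1__paper__paper.tex` (= `…__work__paper-v5-d912a121.tex`, 738 l.), Lemma 4.2(b), proof,
tex ll. 610–611 and 628–631, VERBATIM:

  610–611: Each $I_v$ is absolutely convergent ($\U(W_i)(L_{0,v})$ is compact unless $v$ splits in $L$,
           where it is $L_{0,v}^\times$ acting on $\cS(L_{0,v}^3)$ by $(\omega(y)\phi)(x)=|y|^{3/2}
           \phi(yx)$ up to a unitary character, so that $|\langle\omega_v(y)\phi_v,\phi_v\rangle|
           \ll\min(|y|,|y|^{-1})^{3/2}$)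
  628–631: Enlarging $S$, for $v\notin S$ also $\phi_v=\phi_v^0$ and all splitting data are unramified,
           and $I_v(\phi^0_v)=1$ resp.\ $I_v(\phi^0_v)=\sum_{n\in\Z}q_v^{-3|n|/2}a_v^{n}=(1-q_v^{-3})\,
           |1-a_vq_v^{-3/2}|^{-2}$ at split $v$, where $a_v:=\chi'_v(\varpi_v)\nu_v(\varpi_v)$ with
           $\nu_v$ the (unramified) auxiliary character of the Weil representation, $|a_v|=1$ (measures
           giving the maximal compact subgroups volume $1$).

## What this file does

* **`inner_ball_dilationRep_zpow_tOf`** — in pv07-g2's dilation model (`LocalFactors.DilationModel`: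
  `(ω(y)f)(x) = ν(y) δ(y)^{1/2} f(yx)` on `L²(F³)`, `φ⁰ = 1_B`, `B = closedBall 0 ρ` of volume one, `ν`
  unramified) the lattice coefficients are `⟪1_B, ω(ϖⁿ)1_B⟫ = (q^{-3/2})^{|n|} ν(ϖ)ⁿ` with
  **`q := LocalModulus.resIndex ϖ = [𝒪 : ϖ𝒪]`** — pv07-g2's `splitIntegrand_f_eqOn_shell_resIndex` (their
  `…_tOf` with its displayed hypothesis `hq : δ_F(ϖ) = q⁻¹`, "[Weil BNT I §4 Thm 6]", DISCHARGED KERNEL by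
  this seat's `LocalModulus.distribHaarChar_uniformizer`), specialised to `χ′ = 1` and the lattice point
  `ϖⁿ`; nothing of Weil is cited.
* **`splitPlaceModelOfDilation`** — the D4 DICTIONARY, typed: given the place valuation `ord` on `G i` with
  kernel `B i` and uniformizer `ϖ`, a uniformizer `ϖF` of the local field `F` (`‖ϖF‖ < 1`), and the ONE
  identification the tex asserts at l. 610–611 + 628 restricted to the lattice,
  `coeff_eq : ⟪φ, ω(ι_i ϖⁿ) φ⟫ = ⟪1_B, dilationRep(ϖFⁿ) 1_B⟫` (l. 610–611 "[at split `v`] it is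
  `L_{0,v}^×` acting on `𝒮(L_{0,v}³)` by `(ω(y)φ)(x)=|y|^{3/2}φ(yx)` up to a unitary character", l. 628
  "`φ_v = φ_v⁰`"), it produces
  `SplitShells.SplitPlaceModel B D ω φ χ′ i (resIndex ϖF) (χ′_i ϖ) (ν ϖF)` — hence (SplitShells) the six
  split fields of pv09-g3's `UnramifiedPlaceData` — the numerics being `LocalModulus.two_le_resIndex`
  (`two_le_q`), `norm_chiPi`, `norm_nuPi`.
RESIDUAL (named, typed, not cited): the hypothesis `coeff_eq` itself = tex l. 610–611 + 628 for the
global `ω` (that the restricted-tensor-product Weil representation has the dilation ("Schrödinger") local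
component at a split place under `U(W_{i,v}) ≅ L_{0,v}^×`, and that `φ = ⊗ φ_v` has `φ_v = φ_v⁰ = 1_{𝒪_v³}`
there) — the statement pv09-g3's GAPS calls "D4 model equation"; and the arithmetic normalisation
`resIndex ϖ_v = N(v)` used by the global Euler product (pv13 gen 1 `summable_t`; pv07-g2's `resIndex_padic`
is its `ℚ_p` instance) is set-up bookkeeping of the place indexing, not a claim of the tex proof.
Nothing is cited; no hypothesis names PerL, QW8 or a 2001-programme claim.  Axioms = the standard trio.
Unit `pub-hodgecm-pv13-g3` (DAG-node prover #13, generation 3), 2026-08-18.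

Imports: `Pv13g3.SplitShells` ↦ `HodgeCM.PerL34.SplitShells` (this seat, handed with this file) and the
LANDED (run 24) `HodgeCM.PerL34.LocalFactors.DilationResIndex` (pv07-g2; closure: pv07-g2's `DilationModel`,
`DilationUnramified`, `DilationModulus` and this seat's `HodgeCM.PerL34.LocalModulus`).
-/
import Summits.HodgeConjecture.HodgeCM.PerL34.SplitShells
import Summits.HodgeConjecture.HodgeCM.PerL34.LocalFactors.DilationResIndex

set_option autoImplicit false

noncomputable section

open MeasureTheory MeasureTheory.Measure Set Metric Function Complex ComplexConjugate

open scoped RestrictedProduct InnerProductSpace NNReal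

namespace HodgeCM.PerL34.SplitPlaceDilation

open HodgeCM.PerL34.PureTensor HodgeCM.PerL34.AdelicFactorisation HodgeCM.PerL34.RestrictedMeasure
  HodgeCM.PerL34.EulerFactorisation HodgeCM.PerL34.LocalFactors.DilationModel HodgeCM.PerL34.LocalModulus
  HodgeCM.PerL34.SplitShells

/-! ## §1 The lattice coefficients of the dilation model, `q` kernel -/

section model

variable {F : Type} [NontriviallyNormedField F] [IsUltrametricDist F] [ProperSpace F]

attribute [local instance] unitsBorel

omit [IsUltrametricDist F] [ProperSpace F] in
/-- `borel Fˣ` is a Borel structure (pv07-g2's local instance, re-registered locally) -/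
theorem borelSpace_units' : BorelSpace Fˣ := borelSpace_units

attribute [local instance] borelSpace_units'

omit [IsUltrametricDist F] [ProperSpace F] in
/-- (Ported verbatim from the HodgeCMPerL package; no docstring in the source.) -/
theorem zpow_mem_shell (ϖ : Fˣ) (n : ℤ) : ϖ ^ n ∈ LocalFactors.DilationModel.shell ϖ n := by
  rw [mem_shell_iff, Units.val_zpow_eq_zpow_val, norm_zpow]

omit [IsUltrametricDist F] [ProperSpace F] in
/-- `‖ν(ϖF)‖ = 1` (numerics field `nu_norm`) -/
theorem norm_nuPi (ν : Fˣ →* Circle) (ϖF : Fˣ) : ‖((ν ϖF : Circle) : ℂ)‖ = 1 := Circle.norm_coe _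

variable [MeasurableSpace (Fin 3 → F)] [BorelSpace (Fin 3 → F)] (μV : Measure (Fin 3 → F)) [μV.IsAddHaarMeasure]
  (ρ : ℝ) (ν : Fˣ →* Circle)

/-- the model integrand with trivial `χ′` IS the coefficient -/
theorem splitIntegrand_one_f (μG : Measure Fˣ) [μG.IsHaarMeasure] [μG.Regular] (y : Fˣ) :
    (splitIntegrand μV 0 ρ μG ν 1).f y = ⟪ballIndicator μV 0 ρ, dilationRep μV ν y (ballIndicator μV 0 ρ)⟫_ℂ := by
  change ⟪ballIndicator μV 0 ρ, dilationRep μV ν y (ballIndicator μV 0 ρ)⟫_ℂ * (((1 : Fˣ →* Circle) y : Circle) : ℂ)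
    = _
  rw [MonoidHom.one_apply, Circle.coe_one, mul_one]

/-- **Tex l. 629–630 with `q_v` kernel**: `⟪1_B, ω(ϖⁿ) 1_B⟫ = (q^{-3/2})^{|n|} ν(ϖ)ⁿ`, `q = [𝒪 : ϖ𝒪]`, for
`vol(B) = 1`, `ν` unramified and `‖ϖ‖ < 1` (`2 ≤ q`: `LocalModulus.two_le_resIndex`). -/
theorem inner_ball_dilationRep_zpow_tOf (ϖ : Fˣ) (hϖ : ‖(ϖ : F)‖ < 1)
    (hν : ∀ u : Fˣ, ‖(u : F)‖ = 1 → ν u = 1) (hvol : μV.real (closedBall (0 : Fin 3 → F) ρ) = 1) (n : ℤ) :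
    ⟪ballIndicator μV 0 ρ, dilationRep μV ν (ϖ ^ n) (ballIndicator μV 0 ρ)⟫_ℂ
      = ((EulerProduct.tOf (resIndex ϖ) : ℝ) : ℂ) ^ n.natAbs * ((ν ϖ : Circle) : ℂ) ^ n := by
  have key := splitIntegrand_f_eqOn_shell_resIndex μV ρ ν Measure.haar (1 : Fˣ →* Circle) ϖ hϖ hν
    (fun _ _ => rfl) hvol n (zpow_mem_shell ϖ n)
  rw [← splitIntegrand_one_f μV ρ ν Measure.haar, key]
  simp only [MonoidHom.one_apply, Circle.coe_one, one_mul]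

end model

/-! ## §2 The D4 dictionary: `SplitPlaceModel` from the dilation model -/

section dictionary

variable {ι : Type} {G : ι → Type} [∀ i, CommGroup (G i)] [∀ i, MeasurableSpace (G i)]
  {Sub : ι → Type*} [∀ i, SetLike (Sub i) (G i)] [∀ i, SubgroupClass (Sub i) (G i)]
  (B : ∀ i, Sub i) [DecidableEq ι]
  {Sp : Type} [NormedAddCommGroup Sp] [InnerProductSpace ℂ Sp]
  (D : RestrictedProductMeasureDatum ι G (Πʳ j, [G j, B j]))
  (ω : (Πʳ j, [G j, B j]) →* (Sp ≃ₗᵢ[ℂ] Sp)) (φ : Sp) (χ : (Πʳ j, [G j, B j]) →* Circle)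
  {F : Type} [NontriviallyNormedField F] [IsUltrametricDist F] [ProperSpace F]
  [MeasurableSpace (Fin 3 → F)] [BorelSpace (Fin 3 → F)] (μV : Measure (Fin 3 → F)) [μV.IsAddHaarMeasure]
  (ρ : ℝ) (ν : Fˣ →* Circle)

/-- **The D4 dictionary ⇒ the split-place datum.**  Place-`i` set-up data (`ord`, `ϖ`, `ker ord = B i`,
`B i` measurable of volume one, `φ` fixed by `ω(ι_i 𝒪_v^×)`, `χ′` unramified), a uniformizer `ϖF` of `F`,
`ν` unramified, `vol(B) = 1`, and the lattice identification `coeff_eq` (tex l. 610–611 on `{ϖⁿ}`) give the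
`SplitPlaceModel` with `q = resIndex ϖF`, `chiPi = χ′_i(ϖ)`, `nuPi = ν(ϖF)`. -/
def splitPlaceModelOfDilation (i : ι) (ord : G i →* Multiplicative ℤ) (ϖ : G i)
    (ord_ϖ : ord ϖ = Multiplicative.ofAdd 1) (ker_ord : ∀ g : G i, ord g = 1 ↔ g ∈ B i)
    (measurableSet_B : MeasurableSet (B i : Set (G i))) (vol_B : D.ν i (B i : Set (G i)) = 1)
    (fixed : ∀ b : G i, b ∈ B i → ω (RestrictedProduct.mulSingle B i b) φ = φ)
    (unram : ∀ b : G i, b ∈ B i → χ (RestrictedProduct.mulSingle B i b) = 1)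
    (ϖF : Fˣ) (hϖF : ‖(ϖF : F)‖ < 1) (hν : ∀ u : Fˣ, ‖(u : F)‖ = 1 → ν u = 1)
    (hvol : μV.real (closedBall (0 : Fin 3 → F) ρ) = 1)
    (coeff_eq : ∀ n : ℤ, localCoeff B ω φ i (ϖ ^ n)
      = ⟪ballIndicator μV 0 ρ, dilationRep μV ν (ϖF ^ n) (ballIndicator μV 0 ρ)⟫_ℂ) :
    SplitPlaceModel B D ω φ χ i (resIndex ϖF)
      (((χ (RestrictedProduct.mulSingle B i ϖ) : Circle) : ℂ)) (((ν ϖF : Circle) : ℂ)) where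
  ord := ord
  ϖ := ϖ
  ord_ϖ := ord_ϖ
  ker_ord := ker_ord
  measurableSet_B := measurableSet_B
  vol_B := vol_B
  fixed := fixed
  unram := unram
  chiPi_eq := rfl
  coeff_zpow n := by rw [coeff_eq n, inner_ball_dilationRep_zpow_tOf μV ρ ν ϖF hϖF hν hvol n]

omit [∀ i, MeasurableSpace (G i)] in
/-- `‖χ′_i(ϖ)‖ = 1` (numerics field `chi_norm`) -/
theorem norm_chiPi (i : ι) (ϖ : G i) : ‖((χ (RestrictedProduct.mulSingle B i ϖ) : Circle) : ℂ)‖ = 1 :=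
  Circle.norm_coe _

end dictionary

end HodgeCM.PerL34.SplitPlaceDilation
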